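import Literature.NumberTheory.Automorphic.IsAutomorphicAE
import Literature.NumberTheory.Automorphic.LocalLanglandsDatum
import Literature.NumberTheory.Automorphic.LocalComponentBJ
import Literature.NumberTheory.Automorphic.AdicCompletionLocalField
import Literature.NumberTheory.GaloisRepresentations.WeilDeligneOfGalois
import Literature.NumberTheory.PAdicHodge.FontaineDpst
import HarnessLib

/-!
# Local–global compatibility at EVERY finite place for the Galois representations of Hilbert
# modular eigenforms (Carayol, Taylor, Blasius–Rogawski, Saito, Skinner)

Topic `Literature/NumberTheory/Automorphic` (companion of `HilbertModularGaloisRep`, which carries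
existence — the case `n = 2` of lang.S27 `exists_galoisRep_of_regularAlgebraic` — and Ribet's
irreducibility `galoisRep_GL2_totallyReal_irreducible`; and of `IsAutomorphicAE`, whose
`SatakeFrobCompatibleAE` is the almost-everywhere association `ρ ↔ π` in Buzzard–Gee's
`L`-normalisation).  One NAMED FACT (D-0014), `galoisRep_GL2_totallyReal_localGlobal`.

## The printed theorems

C. Skinner, *A note on the `p`-adic Galois representations attached to Hilbert modular forms*,
Doc. Math. 14 (2009) 241–258 [Skinner2009], §1 (held: `paper:doi-10-4171-dm-272`, pp. 241–242):
`F` totally real, `π = ⊗' π_v` a cuspidal automorphic representation of `GL₂(𝔸_F)` "of infinity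
type `(k, w)`" (each `π_i`, `i ∈ Hom(F, ℂ)`, discrete series of Blattner parameter `k_i ≥ 2`,
central character `x ↦ sgn(x)^{k_i} |x|^{-w}`, `k_i ≡ w (mod 2)` — "an automorphic representation
associated with a Hilbert modular eigenform of weight `k`"), `p` any prime, `ι : ℂ ≅ ℚ̄_p`:
"attached to `π` (and `ι`) is a two-dimensional semisimple Galois representation
`ρ_π : G_F → GL₂(ℚ̄_p)` such that
(1) `WD(ρ_π|_{D_v})^{Fr-ss} ≅ ι Rec_v(π_v ⊗ |·|_v^{-1/2})` for all `v ∤ p∞`",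
where "`Rec_v(τ)` denotes the Frobenius semi-simple Weil–Deligne representation over `ℂ`
associated with an irreducible admissible representation `τ` of `GL_n(F_v)` by the local
Langlands correspondence … We choose `Rec_v` so that when `n = 1`, `Rec_v` is the inverse of the
Artin map of local class field theory normalized so that uniformizers correspond to geometric
frobenius elements.  The existence of a `ρ_π` satisfying (1) was established by Carayol [Ca2],
Wiles [W], Blasius and Rogawski [BR], and Taylor [Tay1]"; and
**Theorem 1.** "Let `v ∣ p` be a place of `F`.  The representation `ρ_π|_{D_v}` is potentially
semistable with Hodge–Tate type `(k, w)` and satisfies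
(2) `WD(ρ_π|_{D_v})^{Fr-ss} ≅ ι Rec_v(π_v ⊗ |·|_v^{-1/2})`",
`WD` at `v ∣ p` being Fontaine's Weil–Deligne representation on `D_pst` (op. cit. §2.1; Fontaine,
Astérisque 223, Exp. VIII), at `v ∤ p` Grothendieck–Deligne's (Tate 1979, (4.2.1)).  Saito proved
Theorem 1 when `[F:ℚ]` is odd or some `π_w` is square-integrable, Blasius–Rogawski in the motivic
cases, Skinner (and independently T. Liu) in general (op. cit. p. 243).

## Rendering in the tree's vocabulary (read before reviewing)

* **`L`-normalisation.**  The tree's summit `Langlands` and `SatakeFrobCompatibleAE` use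
  Buzzard–Gee's `L`-algebraic normalisation: `π` is `L`-algebraic with a REGULAR infinity type
  (`IsLAlgebraic`, `InfinityType.IsRegular`) and the arithmetic Frobenius on `r` has
  characteristic polynomial `∏ (X - ι⁻¹(α_j⁻¹))` (`arithFrobPolyOfSatake ι q_v 1 α`).  Such a `π`
  is exactly `π' ⊗ |det|^{-1/2}` for a regular algebraic (Clozel) cuspidal `π'`
  (`CuspidalAutomorphicRepData.exists_twist_hasInfinityType`,
  `InfinityType.isCAlgebraic_iff_isLAlgebraic_twist`, `HasSatakeParamAt.of_map_mulChar_detTwist_of_cpow`),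
  i.e. for the automorphic representation `π'` of a cuspidal Hilbert eigenform of weight
  `k_i ≥ 2` (the dictionary of `HilbertModularGaloisRep`, module docstring; Taylor 1995 §1,
  Skinner 2009 §1), and Skinner's `ρ_{π'}` with (1)–(2) for `π'_v ⊗ |·|^{-1/2} = π_v` is the
  `L`-normalised representation of `π`: compatibility reads `WD(r|_{Γ_{F_v}})^{F-ss} ≅ ι⁻¹ rec_v(π_v)`
  UNTWISTED (Buzzard–Gee 2014, Conj. 3.2.2, as in the summit statement).
* **"the" representation.**  The tree has no canonical `ρ_{π,ι}`; the fact is stated for EVERY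
  irreducible `r` attached to `π` at almost all places (`SatakeFrobCompatibleAE ι π.1 r`).  Such an
  `r` is isomorphic to Skinner's semisimple `ρ_π` (Chebotarev and Brauer–Nesbitt — the tree's
  PROVED `FramedGaloisRep.nonempty_equiv_of_hasFrobCharpolyAt_eventually`), and every clause below
  is an isomorphism invariant (`PstWeilDeligneData.conj`, `FramedGaloisRep.isUnramifiedAt_conj_iff`),
  so this is the printed statement, in the phrasing already used by the line `Sketch` of
  `Langlands/IrreducibilityBySelfDuality` (`stub_pairCompatibility`).
* **`Rec_v`.**  The Harris–Taylor normalised local Langlands correspondence of `F_v` is a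
  `LocalLanglandsDatum (v.adicCompletion F)` (geometric Frobenius ↦ uniformiser, its `artin`); the
  tree cannot name THE correspondence (uniqueness caveat of `LocalLanglandsDatum`), so the fact
  says: for every totally real `F` there is ONE family `llc v` (Harris–Taylor's) for which all
  compatibilities hold — the `∃` sits directly under `∀ F`, before every automorphic and Galois
  variable, exactly as `∃ 𝓡` in the summit statement.  In particular the fact inhabits
  `LocalLanglandsDatum (F_v)` for completions of totally real fields (Harris–Taylor 2001 Thm. A /
  Henniart 2000, the named fact `LocalLanglandsDatum.nonempty` restricted to these fields).
* **The clauses** are, symbol for symbol, the body of the summit's `LocalGlobalCompatibleAt`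
  (`Summits/Langlands/Langlands/Statement.lean`) with `𝓡.llc v ↦ llc v` and
  `𝓡.pst ℓ v hv ↦ fontainePstAdicCompletion v ℓ hv` (which is what `ReciprocityData.pst` unfolds
  to): the local component `π_v` (`HasLocalComponentAt`, Flath), `r_v = WD(r|_{Γ_{F_v}})` by the
  Grothendieck–Deligne recipe at `v ∤ ℓ` (`IsWeilDeligneOfLadic`) and through Fontaine's PINNED
  datum at `v ∣ ℓ` (`(fontainePstAdicCompletion v ℓ hv).IsWeilDeligneOf`), its transport
  `ι(r_v)` (`IsTransportAlong`) and `ι(r_v)^{F-ss} ≅ rec_v(π_v)` (`HasFrobSemisimpleClass`); plus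
  "potentially semistable at `v ∣ ℓ`", i.e. de Rham (Berger), `IsDeRhamFramed` for the pinned datum.
  Because the datum at `v ∣ ℓ` is pinned by specification (`FontaineDpst`), the clauses at `v ∣ ℓ`
  are relative to ALL Fontaine-spec data at once — the reading fixed for the summit (D-0018 L2).

## What is NOT here

* Existence and irreducibility of `r` (lang.S27 and `galoisRep_GL2_totallyReal_irreducible`,
  file `HilbertModularGaloisRep`); the `L`-normalised existence statement is DERIVED from them
  problem-side (`Summits/Langlands/Langlands/Theorems/WachComponentCensusLiftB2UnramSplitPInPrint`).
* The Hodge–Tate type `(k, w)` of Theorem 1 (labelled weights; not needed by its first consumer).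
* `n > 2`, CM fields (Caraiani 2012/2014), `v ∣ ∞`.

## References

* C. Skinner, Doc. Math. 14 (2009) 241–258, (1) p. 242 and Thm. 1. [Skinner2009]
* H. Carayol, Ann. Sci. ÉNS 19 (1986) 409–468. [CarayolASENS1986]
* R. Taylor, Invent. Math. 98 (1989) 265–280. [TaylorInventMath1989]
* D. Blasius, J. Rogawski, Invent. Math. 114 (1993) 55–87. [BlasiusRogawski1993]
* M. Harris, R. Taylor, Ann. of Math. Stud. 151 (2001), Thm. A. [HarrisTaylorAMS2001]
* K. Buzzard, T. Gee, LMS Lecture Note Ser. 414 (2014), Conj. 3.2.1–3.2.2, §5.3. [BuzzardGeeLMS2014]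
-/

noncomputable section

open scoped MatrixGroups Matrix NumberField
open NumberField IsDedekindDomain Field Filter

namespace Literature.NumberTheory.Automorphic

open Literature.NumberTheory.GaloisRepresentations

/-- **Local–global compatibility at every finite place for the Galois representations of
cuspidal Hilbert eigenforms** (Carayol 1986; Taylor 1989; Blasius–Rogawski 1993; at `v ∣ ℓ`
Saito, and Skinner 2009, Thm. 1 — quoted with (1), p. 242, in the module docstring), in
Buzzard–Gee's `L`-normalisation and the tree's vocabulary (module docstring, "Rendering").
For every totally real number field `K` there is a family of local Langlands correspondences
`llc v` of the completions `K_v` (Harris–Taylor's `Rec_v`, geometric Frobenius ↦ uniformiser)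
such that: for every cuspidal automorphic representation `π` of `GL₂(𝔸_K)` which is
`L`-algebraic with a regular infinity type (i.e. `π ⊗ |det|^{1/2}` is the representation of a
cuspidal Hilbert eigenform of weight `k_σ ≥ 2`), every prime `ℓ`, every `ι : ℚ̄_ℓ ≃ ℂ` and
every continuous irreducible `r : Γ_K → GL₂(ℚ̄_ℓ)` attached to `π` at almost all places
(`SatakeFrobCompatibleAE`: arithmetic Frobenius with characteristic polynomial
`∏ (X - ι⁻¹(α_j⁻¹))`, so that `r ≅ ρ_{π ⊗ |det|^{1/2}, ι}` of Skinner by Chebotarev and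
Brauer–Nesbitt), (i) `r|_{Γ_{K_v}}` is de Rham (= potentially semistable) at every `v ∣ ℓ` for
Fontaine's pinned datum, and (ii) at EVERY finite place `v` there are the local component `π_v`
of `π`, the Weil–Deligne representation `r_v = WD(r|_{Γ_{K_v}})` (Grothendieck–Deligne at
`v ∤ ℓ`, Fontaine's `WD ∘ D_pst` at `v ∣ ℓ`) and its transport `ι(r_v)` with
`ι(r_v)^{F-ss} ≅ rec_v(π_v)`.  Named fact (D-0014), `∀ hcpt`.
[cite: Skinner2009, (1) p. 242 and Thm. 1] [cite: CarayolASENS1986, Thm. (A) (pp. 410–411)]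
[cite: HarrisTaylorAMS2001, Thm. A] -/
def galoisRep_GL2_totallyReal_localGlobal : Prop :=
  ∀ (K : Type) [Field K] [NumberField K], IsTotallyReal K →
    ∃ llc : ∀ v : HeightOneSpectrum (𝓞 K), LocalLanglandsDatum (v.adicCompletion K),
      ∀ (hcpt : isCompact_glFiniteIntegralLevel 2 K) (π : CuspidalAutomorphicRepData 2 K hcpt),
        π.1.IsLAlgebraic → (∃ T : InfinityType K 2, π.1.HasInfinityType T ∧ T.IsRegular) →
        ∀ (ℓ : ℕ) [Fact ℓ.Prime] (ι : PadicAlgCl ℓ ≃+* ℂ) (r : FramedGaloisRep K (PadicAlgCl ℓ) 2),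
          r.toGaloisRep.IsIrreducible → SatakeFrobCompatibleAE ι π.1 r →
          (∀ (v : HeightOneSpectrum (𝓞 K)) (hv : ((ℓ : ℕ) : 𝓞 K) ∈ v.asIdeal),
              (PAdicHodge.fontainePstAdicCompletion v ℓ hv).IsDeRhamFramed (r.toLocal v)) ∧
          ∀ v : HeightOneSpectrum (𝓞 K),
            ∃ (πv : SmoothIrrep (GL (Fin 2) (v.adicCompletion K)))
              (rv : WeilDeligneRep (v.adicCompletion K) (PadicAlgCl ℓ) (Fin 2 → PadicAlgCl ℓ))
              (rℂ : WeilDeligneRep (v.adicCompletion K) ℂ (Fin 2 → ℂ)),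
              π.1.HasLocalComponentAt v πv.ρ ∧
              (((ℓ : ℕ) : 𝓞 K) ∉ v.asIdeal →
                IsWeilDeligneOfLadic (r.toLocal v).toWeilGroupHom rv) ∧
              (∀ hv : ((ℓ : ℕ) : 𝓞 K) ∈ v.asIdeal,
                (PAdicHodge.fontainePstAdicCompletion v ℓ hv).IsWeilDeligneOf (r.toLocal v) rv) ∧
              rv.IsTransportAlong (ι : PadicAlgCl ℓ →+* ℂ) rℂ ∧
              rℂ.HasFrobSemisimpleClass ((llc v).recGL 2 (IrrClass.mk πv))

/-- Unfolding lemma for `galoisRep_GL2_totallyReal_localGlobal`. [folklore] -/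
theorem galoisRep_GL2_totallyReal_localGlobal_iff :
    galoisRep_GL2_totallyReal_localGlobal ↔
      ∀ (K : Type) [Field K] [NumberField K], IsTotallyReal K →
        ∃ llc : ∀ v : HeightOneSpectrum (𝓞 K), LocalLanglandsDatum (v.adicCompletion K),
          ∀ (hcpt : isCompact_glFiniteIntegralLevel 2 K) (π : CuspidalAutomorphicRepData 2 K hcpt),
            π.1.IsLAlgebraic → (∃ T : InfinityType K 2, π.1.HasInfinityType T ∧ T.IsRegular) →
            ∀ (ℓ : ℕ) [Fact ℓ.Prime] (ι : PadicAlgCl ℓ ≃+* ℂ)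
              (r : FramedGaloisRep K (PadicAlgCl ℓ) 2),
              r.toGaloisRep.IsIrreducible → SatakeFrobCompatibleAE ι π.1 r →
              (∀ (v : HeightOneSpectrum (𝓞 K)) (hv : ((ℓ : ℕ) : 𝓞 K) ∈ v.asIdeal),
                  (PAdicHodge.fontainePstAdicCompletion v ℓ hv).IsDeRhamFramed (r.toLocal v)) ∧
              ∀ v : HeightOneSpectrum (𝓞 K),
                ∃ (πv : SmoothIrrep (GL (Fin 2) (v.adicCompletion K)))
                  (rv : WeilDeligneRep (v.adicCompletion K) (PadicAlgCl ℓ) (Fin 2 → PadicAlgCl ℓ))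
                  (rℂ : WeilDeligneRep (v.adicCompletion K) ℂ (Fin 2 → ℂ)),
                  π.1.HasLocalComponentAt v πv.ρ ∧
                  (((ℓ : ℕ) : 𝓞 K) ∉ v.asIdeal →
                    IsWeilDeligneOfLadic (r.toLocal v).toWeilGroupHom rv) ∧
                  (∀ hv : ((ℓ : ℕ) : 𝓞 K) ∈ v.asIdeal,
                    (PAdicHodge.fontainePstAdicCompletion v ℓ hv).IsWeilDeligneOf
                      (r.toLocal v) rv) ∧
                  rv.IsTransportAlong (ι : PadicAlgCl ℓ →+* ℂ) rℂ ∧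
                  rℂ.HasFrobSemisimpleClass ((llc v).recGL 2 (IrrClass.mk πv)) :=
  Iff.rfl

/-- **The fact inhabits the local Langlands data of the completions of totally real fields**:
its `∃ llc` sits directly under `∀ K` (before every automorphic or Galois hypothesis), so it
yields `LocalLanglandsDatum (v.adicCompletion K)` for every totally real `K` and every finite
place `v` — the named fact `LocalLanglandsDatum.nonempty` (Harris–Taylor 2001, Thm. A) restricted
to these local fields.  Recorded as the lower bound on the fact's strength.
[cite: HarrisTaylorAMS2001, Thm. A] -/
theorem nonempty_localLanglandsDatum_of_galoisRep_GL2_totallyReal_localGlobal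
    (h : galoisRep_GL2_totallyReal_localGlobal) (K : Type) [Field K] [NumberField K]
    (hK : IsTotallyReal K) (v : HeightOneSpectrum (𝓞 K)) :
    Nonempty (LocalLanglandsDatum (v.adicCompletion K)) := by
  obtain ⟨llc, -⟩ := h K hK
  exact ⟨llc v⟩

end Literature.NumberTheory.Automorphic

end
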